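/-
Copyright (c) 2026 the pub-hodgecm-mathlib formalisation cell (harness21).  Prover seat hodgecm-mathlib-F0P3a-p01 (g37), FLOOR 0, SUPPORTS-ONLY on h413; β-BOARD v1 R10
(assembler): the `hRest` glue, part 3 — the per-tower DISPATCHER of the rest shapes of tower 1 onto the row heads (★ cell zero, R7 A∕B∕C, A′, R6).  2026-09-04.
-/
import Summits.HodgeConjecture.HodgeConjecture.Theorems.F0P3cDyRamLabelledOddGluedOffFootHigh   -- ★-pending p861495 (this seat): A′; brings ★ p860827 (G₁ cell column + zero-twin)
import Summits.HodgeConjecture.HodgeConjecture.Theorems.F0P3cDyRamStageOneBDefs               -- ★ DEFS №5: `mcOfRecord`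
import Summits.HodgeConjecture.HodgeConjecture.Theorems.F0P3cDyRamElementDatumParity          -- ★: `isoceles_of_isElementDatum`, `depth_mod_two_eq_of_isElementDatum`
import HarnessLib

/-!
# Crux `H413`, LH4 «(D-RAM) FOUR-FRAME» road, STAGE 1b (β) — THE `hRest` GLUE, PART 3: THE TOWER-1 DISPATCHER — every NON-TUBE glued stratum `![2ρ, 2ρ+s, 2ρ+s]` gets its
# value from exactly one of {★ p860827 cell zero, R7-A, A′ (★-pending p861495), R7-B, R7-C, R6}, giving the socket letter `VG 0 ρ s = [2ρ+ℓ₀ = n₂ ∧ n₁ ≠ n₂+s]·κ ρ s`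

Cell `hodgecm-mathlib` (D-0151), FLOOR 0, crux item H413 = `stmt-HodgeConjecture-24833`, route `HCCMUnconditional`; squad F0∕P3c∕LH4.  THEOREMS ONLY (no `def`, no instance, no
notation, no `sorry`, default heartbeats); lane `--supports stmt-HodgeConjecture-24833 --as helper` (count-neutral; pays NO row).

THE DISPATCH (assembler's coverage ledger 15:16:06Z ∕ 15:37:37Z, LH7-p05 (g0) SIG-R7 c4b08d36 case map + the cell A′).  At one datum, for `ρ, s ≥ 1`, `2 ∣ s` and NOT (read ∧ cap)
(`read := 2ρ+s+ℓ₀ = n₁`, `cap := 2ρ+2+ℓ₀ ≤ min n₂ n₃`): (1) in the one-slot cell `2ρ + m* ≤ n₂` read would force cap, so ¬read and ★ p860827's token-free zero applies; (2) beyond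
the cell on the κ-locus `2ρ+ℓ₀ = n₂`: off the foot ⇒ R6 (value `κ ρ s`, the hypothesis `hR6`), on the foot ⇒ R7-C (`n₂ ≤ 2ρ+ℓ₀`, `2ρ+mc ≤ 2n₂` from `mc ≤ N₀ ≤ n₂`) ⇒ 0;
(3) beyond, off the κ-locus, on the foot ⇒ R7-B (`2ρ+ℓ₀+2 ≤ n₂ ∨ 2n₂ < 2ρ+mc`) else R7-C (parity closes the seam) ⇒ 0; (4) beyond, off the κ-locus, off the foot: read false ⇒ R7-A
⇒ 0; read true ⇒ ¬cap + isosceles + parity give `min n₂ n₃ < 2ρ` ⇒ A′ ⇒ 0.  The four row statements R7-A∕B∕C and R6 enter as HYPOTHESES in their announced shapes (SIG-R7 §2;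
R6 with a free closed form `κ`), so this file is independent of how R6's q-exponent fork (15:35:32Z ledger) resolves; at assembly the ★ names are passed in.
HONEST LABEL.  Count-neutral dispatcher; R6∕R7-A∕B∕C are hypotheses here (R7-A∕B ★-boxed by LH7-p05, C∕R6 pending); `hRest`, (β) OPEN; `HC_CM` is proved only modulo the 7 printed
citations (2 remaining named inputs: hLiu418 = `stmt-HodgeConjecture-24832`, h413 = `stmt-HodgeConjecture-24833`) until rung 0 closes.

## References
* [Kottwitz1986BaseChangeUnits] R. E. Kottwitz, *Base change for unit elements of Hecke algebras*, Compositio Math. 60 (1986), §1 pp. 240–241 (lattice counts by strata).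
* [Rogawski1990] J. D. Rogawski, *Automorphic Representations of Unitary Groups in Three Variables*, Ann. of Math. Stud. 123 (1990), §4.9 Prop. 4.9.1 (a)(b) p. 55.
-/

set_option autoImplicit false

noncomputable section

namespace Summit.HodgeConjecture.HodgeConjecture.Cruxes.H413.F0P3cDyRamLabelledOddRestDispatchG1

open Literature.NumberTheory.Automorphic Literature.NumberTheory.Automorphic.HermitianLattice
open Literature.NumberTheory.Automorphic.UnitaryLatticeTree Literature.NumberTheory.Automorphic.UnitaryThreeFourFrame
open Summit.HodgeConjecture.HodgeConjecture.Cruxes.H413.F0P3cDyRamFourFramePieces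
open Summit.HodgeConjecture.HodgeConjecture.Cruxes.H413.F0P3cDyRamFourFrameCensusDefs
open Summit.HodgeConjecture.HodgeConjecture.Cruxes.H413.F0P3cDyRamStageOneBDefs (mcOfRecord)
open Summit.HodgeConjecture.HodgeConjecture.Cruxes.H413.F0P3cDyRamDiagonalTorusDefs
open Summit.HodgeConjecture.HodgeConjecture.Cruxes.H413.F0P3cDyRamDiagonalStrataDefs
open Summit.HodgeConjecture.HodgeConjecture.Cruxes.H413.F0P3cDyRamLabelledOddCountDefs
open Summit.HodgeConjecture.HodgeConjecture.Cruxes.H413.F0P3cDyRamLabelledOddPureStrataG1 (finsum_stratum_G1_shell_labelledOdd_div_relIndex_eq_zero_of_not)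
open Summit.HodgeConjecture.HodgeConjecture.Cruxes.H413.F0P3cDyRamLabelledOddGluedOffFootHigh (finsum_stratum_G1_shell_labelledOdd_div_relIndex_eq_zero_of_offFoot_of_lt)
open Summit.HodgeConjecture.HodgeConjecture.Cruxes.H413.F0P3cDyRamElementDatumParity (isoceles_of_isElementDatum depth_mod_two_eq_of_isElementDatum)
open scoped Valued WithZero Matrix MatrixGroups

variable {K : Type} [Field K] [Valued K ℤᵐ⁰] {σ : K →+* K} {ϖ : K} {d t : ℕ} {α β : K} {N₀ n₁ n₂ n₃ : ℕ}

/-- **THE TOWER-1 REST DISPATCHER.**  At a ramified datum with `|2| < 1` and an element datum at `N₀ ≥ mcOfRecord d, d`, `T = diag(α,β,1)`: given the four row statements of the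
β-BOARD for tower 1 — R7-A (off foot, off both reads ⇒ 0), R7-B (on foot, tube range or top classes ⇒ 0), R7-C (on foot, window ⇒ 0) and R6 (κ-locus `2ρ+ℓ₀ = n₂` off the foot
⇒ `κ ρ s i`) — every NON-TUBE glued stratum `![2ρ, 2ρ+s, 2ρ+s]` (`ρ, s ≥ 1`, `2 ∣ s`, `¬(2ρ+s+ℓ₀ = n₁ ∧ 2ρ+2+ℓ₀ ≤ min n₂ n₃)`) carries the clean-shell labelled-odd table
`if 2ρ + d%2 = n₂ ∧ n₁ ≠ n₂ + s then κ ρ s i else 0` — the socket letter `VG 0` of ★ `…OddLabelledRestReindex.sum_box_restShape_eq_of_rows`.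
[cite: Kottwitz1986BaseChangeUnits, §1 pp. 240–241] [cite: Rogawski1990, §4.9 Prop. 4.9.1 (a)(b) p. 55] -/
theorem restValue_G1_of_rows (hD : IsRamifiedQuadraticDatum σ ϖ d t) (h2d : 2 ≤ d)
    (hE : IsElementDatum σ ϖ N₀ α β n₁ n₂ n₃) (hdN₀ : d ≤ N₀) (hmc : mcOfRecord d ≤ N₀)
    (T : GL (Fin 3) K) (hT : (T : Matrix (Fin 3) (Fin 3) K) = Matrix.diagonal ![α, β, 1]) (κ : ℕ → ℕ → Fin 3 → ℚ)
    (hA : ∀ (ρ s : ℕ), 1 ≤ ρ → 1 ≤ s → n₁ ≠ n₂ + s → 2 * ρ + s + d % 2 ≠ n₁ → 2 * ρ + d % 2 ≠ n₂ → ∀ i : Fin 3,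
      ∑ᶠ M ∈ {M : Submodule 𝒪[K] (Fin 3 → K) | M ∈ stratum σ ϖ T ![2 * ρ, 2 * ρ + s, 2 * ρ + s] ∧
          (LatticeInLevel ϖ (d % 2) (Matrix.diagonal ![α - 1, β - 1, 0]) M ∧ ¬ LatticeInLevel ϖ (d % 2 + 1) (Matrix.diagonal ![α - 1, β - 1, 0]) M ∧
            LatticeInLevel ϖ (mcOfRecord d) (Matrix.diagonal ![(α - 1) * (α - 1), (β - 1) * (β - 1), 0]) M)},
        (labelledOddCount σ ϖ 0 i (valueClassLabel σ ϖ (α - 1) (β - 1) (mstarOfRecord d) d) M : ℚ) /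
          ((((unitStabilizer M).map (unitNormMap σ 3)).relIndex (fixedUnitTorus σ 3) : ℕ) : ℚ) = 0)
    (hB : ∀ (ρ s : ℕ), 1 ≤ ρ → 1 ≤ s → n₁ = n₂ + s → (2 * ρ + d % 2 + 2 ≤ n₂ ∨ 2 * n₂ < 2 * ρ + mcOfRecord d) → ∀ i : Fin 3,
      ∑ᶠ M ∈ {M : Submodule 𝒪[K] (Fin 3 → K) | M ∈ stratum σ ϖ T ![2 * ρ, 2 * ρ + s, 2 * ρ + s] ∧
          (LatticeInLevel ϖ (d % 2) (Matrix.diagonal ![α - 1, β - 1, 0]) M ∧ ¬ LatticeInLevel ϖ (d % 2 + 1) (Matrix.diagonal ![α - 1, β - 1, 0]) M ∧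
            LatticeInLevel ϖ (mcOfRecord d) (Matrix.diagonal ![(α - 1) * (α - 1), (β - 1) * (β - 1), 0]) M)},
        (labelledOddCount σ ϖ 0 i (valueClassLabel σ ϖ (α - 1) (β - 1) (mstarOfRecord d) d) M : ℚ) /
          ((((unitStabilizer M).map (unitNormMap σ 3)).relIndex (fixedUnitTorus σ 3) : ℕ) : ℚ) = 0)
    (hC : ∀ (ρ s : ℕ), 1 ≤ ρ → 1 ≤ s → n₁ = n₂ + s → n₂ ≤ 2 * ρ + d % 2 → 2 * ρ + mcOfRecord d ≤ 2 * n₂ → ∀ i : Fin 3,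
      ∑ᶠ M ∈ {M : Submodule 𝒪[K] (Fin 3 → K) | M ∈ stratum σ ϖ T ![2 * ρ, 2 * ρ + s, 2 * ρ + s] ∧
          (LatticeInLevel ϖ (d % 2) (Matrix.diagonal ![α - 1, β - 1, 0]) M ∧ ¬ LatticeInLevel ϖ (d % 2 + 1) (Matrix.diagonal ![α - 1, β - 1, 0]) M ∧
            LatticeInLevel ϖ (mcOfRecord d) (Matrix.diagonal ![(α - 1) * (α - 1), (β - 1) * (β - 1), 0]) M)},
        (labelledOddCount σ ϖ 0 i (valueClassLabel σ ϖ (α - 1) (β - 1) (mstarOfRecord d) d) M : ℚ) /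
          ((((unitStabilizer M).map (unitNormMap σ 3)).relIndex (fixedUnitTorus σ 3) : ℕ) : ℚ) = 0)
    (hR6 : ∀ (ρ s : ℕ), 1 ≤ ρ → 1 ≤ s → 2 ∣ s → 2 * ρ + d % 2 = n₂ → n₁ ≠ n₂ + s → ∀ i : Fin 3,
      ∑ᶠ M ∈ {M : Submodule 𝒪[K] (Fin 3 → K) | M ∈ stratum σ ϖ T ![2 * ρ, 2 * ρ + s, 2 * ρ + s] ∧
          (LatticeInLevel ϖ (d % 2) (Matrix.diagonal ![α - 1, β - 1, 0]) M ∧ ¬ LatticeInLevel ϖ (d % 2 + 1) (Matrix.diagonal ![α - 1, β - 1, 0]) M ∧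
            LatticeInLevel ϖ (mcOfRecord d) (Matrix.diagonal ![(α - 1) * (α - 1), (β - 1) * (β - 1), 0]) M)},
        (labelledOddCount σ ϖ 0 i (valueClassLabel σ ϖ (α - 1) (β - 1) (mstarOfRecord d) d) M : ℚ) /
          ((((unitStabilizer M).map (unitNormMap σ 3)).relIndex (fixedUnitTorus σ 3) : ℕ) : ℚ) = κ ρ s i)
    (ρ s : ℕ) (hρ : 1 ≤ ρ) (hs : 1 ≤ s) (h2s : 2 ∣ s) (hnt : ¬ (2 * ρ + s + d % 2 = n₁ ∧ 2 * ρ + 2 + d % 2 ≤ min n₂ n₃)) (i : Fin 3) :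
    ∑ᶠ M ∈ {M : Submodule 𝒪[K] (Fin 3 → K) | M ∈ stratum σ ϖ T ![2 * ρ, 2 * ρ + s, 2 * ρ + s] ∧
        (LatticeInLevel ϖ (d % 2) (Matrix.diagonal ![α - 1, β - 1, 0]) M ∧ ¬ LatticeInLevel ϖ (d % 2 + 1) (Matrix.diagonal ![α - 1, β - 1, 0]) M ∧
          LatticeInLevel ϖ (mcOfRecord d) (Matrix.diagonal ![(α - 1) * (α - 1), (β - 1) * (β - 1), 0]) M)},
      (labelledOddCount σ ϖ 0 i (valueClassLabel σ ϖ (α - 1) (β - 1) (mstarOfRecord d) d) M : ℚ) /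
        ((((unitStabilizer M).map (unitNormMap σ 3)).relIndex (fixedUnitTorus σ 3) : ℕ) : ℚ) =
      if 2 * ρ + d % 2 = n₂ ∧ n₁ ≠ n₂ + s then κ ρ s i else 0 := by
  -- letters of the datum
  have hiso := isoceles_of_isElementDatum hD hE
  obtain ⟨hp1, hp2, hp3⟩ := depth_mod_two_eq_of_isElementDatum hD hE hdN₀
  have hn₁ : N₀ ≤ n₁ := hE.2.2.2.2.2.2.2.2.1
  have hn₂ : N₀ ≤ n₂ := hE.2.2.2.2.2.2.2.2.2.1
  have hn₃ : N₀ ≤ n₃ := hE.2.2.2.2.2.2.2.2.2.2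
  have hms : mstarOfRecord d = d % 2 + 2 * d - 1 := rfl
  have hmcv : mcOfRecord d = 2 * ((d % 2 + 2 * d - 1 + d) / 2) := rfl
  have hd2 := Nat.mod_two_eq_zero_or_one d
  by_cases hcell : 2 * ρ + mstarOfRecord d ≤ n₂
  · -- (1) the one-slot cell: read ⇒ cap, hence ¬read; ★ p860827's token-free zero
    have hcell' := hcell
    rw [hms] at hcell'
    have hnot : ¬ (2 * ρ + s + d % 2 = n₁ ∧ 2 ∣ s ∧ 2 * ρ ≤ min n₂ n₃) := by
      rintro ⟨hread, -, -⟩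
      apply hnt
      refine ⟨hread, ?_⟩
      rcases hiso with ⟨h12, h13⟩ | ⟨h13, h12⟩ | ⟨h23, h21⟩
      · rw [le_min_iff]; constructor <;> omega
      · rw [le_min_iff]; constructor <;> omega
      · rw [le_min_iff]; constructor <;> omega
    rw [finsum_stratum_G1_shell_labelledOdd_div_relIndex_eq_zero_of_not hD h2d hE hmc T hT ρ s hρ hs hcell hnot i]
    rw [if_neg]
    rintro ⟨hκ, -⟩
    omega
  · rw [hms] at hcell
    by_cases hκ : 2 * ρ + d % 2 = n₂
    · by_cases hfoot : n₁ = n₂ + s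
      · -- (2b) on the foot at the κ-locus: R7-C
        rw [hC ρ s hρ hs hfoot (by omega) (by rw [hmcv]; omega) i, if_neg]
        exact fun h => h.2 hfoot
      · -- (2a) off the foot at the κ-locus: R6
        rw [hR6 ρ s hρ hs h2s hκ hfoot i, if_pos ⟨hκ, hfoot⟩]
    · rw [if_neg (fun h => hκ h.1)]
      by_cases hfoot : n₁ = n₂ + s
      · -- (3) on the foot, off the κ-locus: R7-B or R7-C
        by_cases hoff : 2 * ρ + d % 2 + 2 ≤ n₂ ∨ 2 * n₂ < 2 * ρ + mcOfRecord d
        · exact hB ρ s hρ hs hfoot hoff i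
        · rw [not_or, not_le, not_lt] at hoff
          exact hC ρ s hρ hs hfoot (by omega) hoff.2 i
      · by_cases hread : 2 * ρ + s + d % 2 = n₁
        · -- (4b) off the foot, off the κ-locus, read TRUE: ¬cap ⇒ min n₂ n₃ < 2ρ ⇒ A′
          have hcap : ¬ 2 * ρ + 2 + d % 2 ≤ min n₂ n₃ := fun h => hnt ⟨hread, h⟩
          have hlt : min n₂ n₃ < 2 * ρ := by
            rw [not_le] at hcap
            rcases hiso with ⟨h12, h13⟩ | ⟨h13, h12⟩ | ⟨h23, h21⟩
            · rw [min_eq_left (by omega)] at hcap ⊢; omega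
            · rw [min_eq_right (by omega)] at hcap ⊢; omega
            · rw [min_eq_left (by omega)] at hcap ⊢; omega
          exact finsum_stratum_G1_shell_labelledOdd_div_relIndex_eq_zero_of_offFoot_of_lt hD hE T hT ρ s hρ hs hfoot hlt _ i _
        · -- (4a) off the foot, off both reads: R7-A
          exact hA ρ s hρ hs hfoot hread hκ i

end Summit.HodgeConjecture.HodgeConjecture.Cruxes.H413.F0P3cDyRamLabelledOddRestDispatchG1

end
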